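import Summits.QuantumFields.YangMills.Theorems.LangevinControlUVOSLegsFromFemtoAndGapDefs
import Literature.MathematicalPhysics.QuantumLattice.LatticeFieldShellMarkov
import HarnessLib

/-!
# Crux `NT` (stmt-QuantumFields-19353), strong-coupling rung: lattice-scale test functions — `Q2`, `Q3` of bumps at
# lattice sites are single covariances / third cumulants (bookkeeping toward `LowerBounds`' SHAPE at strong coupling)

Helper file of the fleet lead prover of crux `NT` (unit `ym-spine-19353-p1`, g18).  NT's non-triviality inputs
`LowerBounds G r a` (`…OSLegsFromFemtoAndGap.DlrCollarTransfer`) are phrased with the SMEARED functionals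
`Q2 G r β L s f g = Σ_{x,y ∈ box L} f(s x) g(s y) Cov^{torus}(dens_x, dens_y)` and `Q3` (three test functions, `torusK3`).
At the lattice scale `s = 1` a Schwartz bump of radius `< 1` around a lattice site sees exactly that site, so `Q2`/`Q3` of
such bumps are ONE covariance / ONE third cumulant times the bump values — which is how the strong-coupling floors
`MirrorFloorSU2`/`SkewFloor` (sites `±e₀`; `e₀, e₁, e₂`) become statements of `LowerBounds`' literal shape:

* `apply_siteToE_eq_zero_of_subset_ball` — a function supported in `B(site x₀, R)`, `R ≤ 1`, vanishes at every other site;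
* `Q2_eq_single`, `Q3_eq_single` — `Q2`/`Q3` at `s = 1` of test functions vanishing at all sites but `x₀, y₀ (, z₀) ∈ box L`;
* `thetaTest_apply_siteToE_neg_single`, `thetaTest_apply_siteToE_eq_zero` — the time reflection `Θv` of a bump at `e₀`
  sees exactly the site `−e₀`;
* `exists_mirror_test` — ONE real Schwartz `v` with `tsupport v ⊆ {y | 0 < y 0}` and, on every torus `L ≥ 1`, every `β`,
  every compact `G` and `r`:  `Q2 G r β L 1 (Θv) v = v(e₀)² · Cov^{torus}(dens_{e₀}, dens_{−e₀})`, `v(e₀)² > 0`;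
* `exists_skew_tests` — THREE real Schwartz `f, g, h` with pairwise disjoint supports and
  `Q3 G r β L 1 f g h = f(e₀) g(e₁) h(e₂) · torusK3(e₀, e₁, e₂)`, `f(e₀) g(e₁) h(e₂) ≠ 0`.

HONEST FRAMING: bookkeeping only (Schwartz bumps from Mathlib's `ContDiffBump` via the tree's
`exists_schwartz_tsupport_subset_ball`); nothing about measures beyond unfolding `Q2`/`Q3`; NT untouched.
-/

set_option autoImplicit false

noncomputable section

open scoped SchwartzMap
open MeasureTheory Metric Finset
open Literature.MathematicalPhysics.QuantumFieldTheory Literature.MathematicalPhysics.QuantumLattice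
open Literature.MathematicalPhysics.AQFT Literature.Probability.LatticeModels
open Summit.QuantumFields.YangMills.Cruxes.OSLegsFromFemtoAndGap.DlrCollarTransfer

namespace Summit.QuantumFields.YangMills.Cruxes.NT.StrongCouplingRung.LatticeBumps

/-! ### Functions supported near one lattice site -/

/-- A function on `ℝ⁴` whose topological support lies in the ball of radius `R ≤ 1` around the lattice site `x₀`
vanishes at every other lattice site (distinct sites are at distance `≥ 1`). [folklore] -/
theorem apply_siteToE_eq_zero_of_subset_ball {f : EuclideanSpace ℝ (Fin 4) → ℝ} {x₀ : Site 4} {R : ℝ} (hR : R ≤ 1)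
    (hf : tsupport f ⊆ ball (siteToE x₀) R) {y : Site 4} (hy : y ≠ x₀) : f (siteToE y) = 0 := by
  apply image_eq_zero_of_notMem_tsupport
  intro hmem
  have h1 := one_le_dist_siteToE_of_ne hy
  have h2 := mem_ball.1 (hf hmem)
  linarith

/-- The unit site vectors `eᵢ` and `−e₀` belong to every box `[-L, L]⁴` with `1 ≤ L`. [folklore] -/
theorem single_mem_box {L : ℕ} (hL : 1 ≤ L) (i : Fin 4) : (Pi.single i 1 : Site 4) ∈ box 4 L := by
  rw [mem_box]
  intro j
  by_cases h : j = i
  · subst h; simp; omega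
  · simp [Pi.single_eq_of_ne h]

/-- `−e₀ ∈ [-L, L]⁴` for `1 ≤ L`. [folklore] -/
theorem neg_single_mem_box {L : ℕ} (hL : 1 ≤ L) (i : Fin 4) : (-(Pi.single i 1) : Site 4) ∈ box 4 L := by
  rw [mem_box]
  intro j
  by_cases h : j = i
  · subst h; simp; omega
  · simp [Pi.single_eq_of_ne h]

/-! ### `Q2` and `Q3` at the lattice scale of test functions seen by one site each -/

section QSingle

variable (G : Type) [Group G] [TopologicalSpace G] [IsTopologicalGroup G] [CompactSpace G]
  [MeasurableSpace G] [BorelSpace G] (r : LatticeRep G)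

/-- **`Q2` of single-site test functions.**  If `f` vanishes at every site of the box other than `x₀` and `g` at every
site other than `y₀`, then `Q2 G r β L 1 f g = f(x₀) g(y₀) · Cov^{torus}(dens_{x₀}, dens_{y₀})`. [folklore] -/
theorem Q2_eq_single (β : ℝ) {L : ℕ} (f g : 𝓢(EuclideanSpace ℝ (Fin 4), ℝ)) {x₀ y₀ : Site 4}
    (hx₀ : x₀ ∈ box 4 L) (hy₀ : y₀ ∈ box 4 L) (hf : ∀ x : Site 4, x ≠ x₀ → f (siteToE x) = 0)
    (hg : ∀ y : Site 4, y ≠ y₀ → g (siteToE y) = 0) :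
    Q2 G r β L 1 f g = f (siteToE x₀) * g (siteToE y₀) *
      (torusE G r β L (fun U => dens G r x₀ U * dens G r y₀ U) - torusE G r β L (dens G r x₀) * torusE G r β L (dens G r y₀)) := by
  unfold Q2
  simp only [one_smul]
  rw [sum_eq_single_of_mem x₀ hx₀ (fun x _ hx => by
    refine sum_eq_zero fun y _ => ?_
    rw [hf x hx, zero_mul, zero_mul])]
  rw [sum_eq_single_of_mem y₀ hy₀ (fun y _ hy => by rw [hg y hy, mul_zero, zero_mul])]

/-- **`Q3` of single-site test functions.**  If `f, g, h` vanish at every site other than `x₀, y₀, z₀` respectively, then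
`Q3 G r β L 1 f g h = f(x₀) g(y₀) h(z₀) · torusK3(x₀, y₀, z₀)`. [folklore] -/
theorem Q3_eq_single (β : ℝ) {L : ℕ} (f g h : 𝓢(EuclideanSpace ℝ (Fin 4), ℝ)) {x₀ y₀ z₀ : Site 4}
    (hx₀ : x₀ ∈ box 4 L) (hy₀ : y₀ ∈ box 4 L) (hz₀ : z₀ ∈ box 4 L) (hf : ∀ x : Site 4, x ≠ x₀ → f (siteToE x) = 0)
    (hg : ∀ y : Site 4, y ≠ y₀ → g (siteToE y) = 0) (hh : ∀ z : Site 4, z ≠ z₀ → h (siteToE z) = 0) :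
    Q3 G r β L 1 f g h = f (siteToE x₀) * g (siteToE y₀) * h (siteToE z₀) * torusK3 G r β L x₀ y₀ z₀ := by
  unfold Q3
  simp only [one_smul]
  rw [sum_eq_single_of_mem x₀ hx₀ (fun x _ hx => by
    refine sum_eq_zero fun y _ => sum_eq_zero fun z _ => ?_
    rw [hf x hx, zero_mul, zero_mul, zero_mul])]
  rw [sum_eq_single_of_mem y₀ hy₀ (fun y _ hy => by
    refine sum_eq_zero fun z _ => ?_
    rw [hg y hy, mul_zero, zero_mul, zero_mul])]
  rw [sum_eq_single_of_mem z₀ hz₀ (fun z _ hz => by rw [hh z hz, mul_zero, zero_mul])]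

end QSingle

/-! ### The time reflection of a bump at `e₀` -/

/-- `θ (site y) = site (y with its time coordinate negated)`. [folklore] -/
theorem timeReflection_siteToE (y : Site 4) :
    timeReflection 4 (siteToE y) = siteToE (Function.update y 0 (-y 0)) := by
  ext i
  rw [timeReflection_apply, siteToE_apply, siteToE_apply]
  by_cases h : i = 0
  · subst h; simp
  · simp [h]

/-- The reflected site of `−e₀` is `e₀`. [folklore] -/
theorem update_neg_single : Function.update (-(Pi.single 0 1) : Site 4) 0 (-(-(Pi.single 0 1) : Site 4) 0) = Pi.single 0 1 := by
  ext i
  by_cases h : i = 0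
  · subst h; simp
  · simp [Function.update_of_ne h, Pi.single_eq_of_ne h]

/-- `(Θv)(−e₀) = v(e₀)`. [folklore] -/
theorem thetaTest_apply_siteToE_neg_single (v : 𝓢(EuclideanSpace ℝ (Fin 4), ℝ)) :
    thetaTest 4 v (siteToE (-(Pi.single 0 1) : Site 4)) = v (siteToE (Pi.single 0 1 : Site 4)) := by
  rw [thetaTest_apply, timeReflection_siteToE, update_neg_single]

/-- A test function supported in `B(e₀, R)`, `R ≤ 1`: its time reflection vanishes at every site other than `−e₀`.
[folklore] -/
theorem thetaTest_apply_siteToE_eq_zero {v : 𝓢(EuclideanSpace ℝ (Fin 4), ℝ)} {R : ℝ} (hR : R ≤ 1)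
    (hv : tsupport (v : EuclideanSpace ℝ (Fin 4) → ℝ) ⊆ ball (siteToE (Pi.single 0 1 : Site 4)) R) {y : Site 4}
    (hy : y ≠ -(Pi.single 0 1)) : thetaTest 4 v (siteToE y) = 0 := by
  rw [thetaTest_apply, timeReflection_siteToE]
  refine apply_siteToE_eq_zero_of_subset_ball hR hv fun h => hy ?_
  -- `update y 0 (-y 0) = e₀` forces `y = -e₀`
  ext i
  have hi := congrFun h i
  by_cases h0 : i = 0
  · subst h0
    simp at hi
    simp
    linarith
  · rw [Function.update_of_ne h0] at hi
    rw [hi]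
    simp [Pi.single_eq_of_ne h0]

/-- The ball of radius `1/2` around `e₀` lies in positive time. [folklore] -/
theorem ball_single_subset_pos :
    ball (siteToE (Pi.single 0 1 : Site 4)) (1 / 2 : ℝ) ⊆ {y : EuclideanSpace ℝ (Fin 4) | 0 < y 0} := by
  intro y hy
  rw [mem_ball] at hy
  have h1 : dist (y 0) (siteToE (Pi.single 0 1 : Site 4) 0) ≤ dist y (siteToE (Pi.single 0 1 : Site 4)) :=
    PiLp.dist_apply_le y _ 0
  rw [siteToE_apply, Real.dist_eq] at h1
  simp only [Pi.single_eq_same, Int.cast_one] at h1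
  show 0 < y 0
  have := abs_lt.1 (lt_of_le_of_lt h1 hy)
  linarith [this.1]

/-! ### The two packaged witnesses -/

/-- **The mirror test function.**  ONE real Schwartz `v` supported in positive time with `v(e₀)² > 0` such that, for every
compact `G`, every `r`, every `β` and every torus `L ≥ 1`, `Q2 G r β L 1 (Θv) v = v(e₀)² · Cov^{torus}(dens_{e₀}, dens_{−e₀})`.
[folklore] -/
theorem exists_mirror_test :
    ∃ v : 𝓢(EuclideanSpace ℝ (Fin 4), ℝ), tsupport (v : EuclideanSpace ℝ (Fin 4) → ℝ) ⊆ {y | 0 < y 0} ∧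
      0 < v (siteToE (Pi.single 0 1 : Site 4)) ^ 2 ∧
      ∀ (G : Type) [Group G] [TopologicalSpace G] [IsTopologicalGroup G] [CompactSpace G] [MeasurableSpace G]
        [BorelSpace G] (r : LatticeRep G) (β : ℝ) (L : ℕ), 1 ≤ L →
        Q2 G r β L 1 (thetaTest 4 v) v = v (siteToE (Pi.single 0 1 : Site 4)) ^ 2 *
          (torusE G r β L (fun U => dens G r (Pi.single 0 1) U * dens G r (-(Pi.single 0 1)) U) -
            torusE G r β L (dens G r (Pi.single 0 1)) * torusE G r β L (dens G r (-(Pi.single 0 1)))) := by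
  obtain ⟨v, hv, hv0⟩ := exists_schwartz_tsupport_subset_ball (siteToE (Pi.single 0 1 : Site 4)) (R := 1 / 2)
    (by norm_num)
  refine ⟨v, hv.trans ball_single_subset_pos, sq_pos_of_ne_zero hv0, ?_⟩
  intro G _ _ _ _ _ _ r β L hL
  rw [Q2_eq_single G r β (thetaTest 4 v) v (neg_single_mem_box hL 0) (single_mem_box hL 0)
    (fun x hx => thetaTest_apply_siteToE_eq_zero (by norm_num) hv hx)
    (fun y hy => apply_siteToE_eq_zero_of_subset_ball (by norm_num) hv hy),
    thetaTest_apply_siteToE_neg_single, sq,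
    mul_comm (torusE G r β L (dens G r (-(Pi.single 0 1)))) (torusE G r β L (dens G r (Pi.single 0 1)))]
  congr 2
  exact congrArg (torusE G r β L) (funext fun U => mul_comm _ _)

/-- The three unit sites `e₀, e₁, e₂` are pairwise distinct. [folklore] -/
theorem single_ne_single {i j : Fin 4} (h : i ≠ j) : (Pi.single i 1 : Site 4) ≠ Pi.single j 1 := fun e => by
  have := congrFun e i
  simp [Pi.single_eq_of_ne h] at this

/-- Balls of radius `1/2` around distinct lattice sites have disjoint closures' interiors: the supports of bumps in them
are disjoint. [folklore] -/
theorem disjoint_of_subset_ball {f g : EuclideanSpace ℝ (Fin 4) → ℝ} {x y : Site 4} (hxy : x ≠ y)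
    (hf : tsupport f ⊆ ball (siteToE x) (1 / 2 : ℝ)) (hg : tsupport g ⊆ ball (siteToE y) (1 / 2 : ℝ)) :
    Disjoint (tsupport f) (tsupport g) := by
  refine Set.disjoint_of_subset hf hg (ball_disjoint_ball ?_)
  have := one_le_dist_siteToE_of_ne hxy
  linarith

/-- **The skewness test functions.**  THREE real Schwartz `f, g, h` with pairwise disjoint supports and
`f(e₀) g(e₁) h(e₂) ≠ 0` such that, for every compact `G`, every `r`, every `β` and every torus `L ≥ 1`,
`Q3 G r β L 1 f g h = f(e₀) g(e₁) h(e₂) · torusK3(e₀, e₁, e₂)`. [folklore] -/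
theorem exists_skew_tests :
    ∃ f g h : 𝓢(EuclideanSpace ℝ (Fin 4), ℝ),
      Disjoint (tsupport (f : EuclideanSpace ℝ (Fin 4) → ℝ)) (tsupport (g : EuclideanSpace ℝ (Fin 4) → ℝ)) ∧
      Disjoint (tsupport (g : EuclideanSpace ℝ (Fin 4) → ℝ)) (tsupport (h : EuclideanSpace ℝ (Fin 4) → ℝ)) ∧
      Disjoint (tsupport (f : EuclideanSpace ℝ (Fin 4) → ℝ)) (tsupport (h : EuclideanSpace ℝ (Fin 4) → ℝ)) ∧
      f (siteToE (Pi.single 0 1 : Site 4)) * g (siteToE (Pi.single 1 1 : Site 4)) *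
          h (siteToE (Pi.single 2 1 : Site 4)) ≠ 0 ∧
      ∀ (G : Type) [Group G] [TopologicalSpace G] [IsTopologicalGroup G] [CompactSpace G] [MeasurableSpace G]
        [BorelSpace G] (r : LatticeRep G) (β : ℝ) (L : ℕ), 1 ≤ L →
        Q3 G r β L 1 f g h = f (siteToE (Pi.single 0 1 : Site 4)) * g (siteToE (Pi.single 1 1 : Site 4)) *
          h (siteToE (Pi.single 2 1 : Site 4)) * torusK3 G r β L (Pi.single 0 1) (Pi.single 1 1) (Pi.single 2 1) := by
  obtain ⟨f, hf, hf0⟩ := exists_schwartz_tsupport_subset_ball (siteToE (Pi.single 0 1 : Site 4)) (R := 1 / 2)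
    (by norm_num)
  obtain ⟨g, hg, hg0⟩ := exists_schwartz_tsupport_subset_ball (siteToE (Pi.single 1 1 : Site 4)) (R := 1 / 2)
    (by norm_num)
  obtain ⟨h, hh, hh0⟩ := exists_schwartz_tsupport_subset_ball (siteToE (Pi.single 2 1 : Site 4)) (R := 1 / 2)
    (by norm_num)
  refine ⟨f, g, h, disjoint_of_subset_ball (single_ne_single (by decide)) hf hg,
    disjoint_of_subset_ball (single_ne_single (by decide)) hg hh,
    disjoint_of_subset_ball (single_ne_single (by decide)) hf hh, mul_ne_zero (mul_ne_zero hf0 hg0) hh0, ?_⟩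
  intro G _ _ _ _ _ _ r β L hL
  exact Q3_eq_single G r β f g h (single_mem_box hL 0) (single_mem_box hL 1) (single_mem_box hL 2)
    (fun x hx => apply_siteToE_eq_zero_of_subset_ball (by norm_num) hf hx)
    (fun y hy => apply_siteToE_eq_zero_of_subset_ball (by norm_num) hg hy)
    (fun z hz => apply_siteToE_eq_zero_of_subset_ball (by norm_num) hh hz)

end Summit.QuantumFields.YangMills.Cruxes.NT.StrongCouplingRung.LatticeBumps

end
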